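import Mathlib
import Summits.ResolutionOfSingularities.ResolutionOfSingularities.Theorems.HomologicalConductorPersistenceSurfaceRational
import Summits.ResolutionOfSingularities.ResolutionOfSingularities.Theorems.HomologicalConductorPersistenceSurfaceRationalAssembly
import HarnessLib

/-!
# Rung S-2 `PersistenceSurface` (stmt-ResolutionOfSingularities-19970) — ORDER w44b-o6b: the NORMAL-RATIONAL /
# REST re-cut of the level-four partition (tri-1 TRIAGE v4 J-A, CHAIN w44b v8.2 §V8.9)

Route `ResolutionOfSingularities/HomologicalConductor`, chain W4.4b (cell res-hironaka). OURS; nothing here is a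
statement of the manuscript under review (Hironaka 2017); AI-written, weaker than expert review.

res-L1-w44b-tri-1's audit J-A (TRIAGE v4 49d1547bf5669974): W4.4's `HasRationalSingularity` (Lipman Def. (1.1) as
typed) carries no normality / dimension clause, so the class (R) of o6 (`…PersistenceSurfaceRational`, p505465) and o8
(`…PersistenceSurfaceRationalAssembly`, p507867) — «stage 0 has a rational singularity or is regular» — also contains
singular curves and non-normal germs with rational normalisation (Σ8 specimens), where programme M-rat₄ does not run.
Those decls STAND (they are the stronger variants); this file RE-CUTS the partition at the M-rat₄ regime proper,
class (R♮) = «stage 0 is NORMAL (`IsIntegrallyClosed`, as in `…PersistenceAdjoinInv`) with a rational singularity, or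
regular», with verbatim copies of the o6/o8 statements and glue:

* `LevelFourPersistenceRationalNormal` / `LevelFourPersistenceNonnormalOrNonrational`,
  `SaturationFourRationalNormal` / `SaturationFourNonnormalOrNonrational` (`@[conjecture]`, binders verbatim those of
  o6, stage-0 hypothesis swapped for (R♮) resp. its negation);
* glue by excluded middle: `levelFourPersistenceSurface_of_rationalNormal_of_rest`,
  `saturationFourSurface_of_rationalNormal_of_rest`, `persistenceSurface_of_normalPieces`;
* free comparisons with o6: `levelFourPersistenceRationalNormal_of_rational`,
  `levelFourPersistenceNonrational_of_rest`, `saturationFourRationalNormal_of_rational`,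
  `saturationFourNonrational_of_rest`;
* `RationalNormalStepDualCover` (`@[conjecture]`; o8's `RationalStepDualCover` with the same swap),
  `rationalNormalStepDualCover_of_rational`, and the assembly
  `levelFourPersistenceRationalNormal_of_rationalNormalStepDualCover` (o8's proof, hypothesis threaded).
-/

set_option linter.dupNamespace false

noncomputable section

namespace Summit.ResolutionOfSingularities.ResolutionOfSingularities.Theorems.HomologicalConductor.PersistenceSurfaceNormalPartition

open Literature.RingTheory.CohomologyAnnihilator
open Summit.ResolutionOfSingularities.ResolutionOfSingularities.Theorems.NoZeno.Birth
open Summit.ResolutionOfSingularities.ResolutionOfSingularities.Theorems.HomologicalConductor.PersistenceSurfaceLevelFour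
open Summit.ResolutionOfSingularities.ResolutionOfSingularities.Theorems.HomologicalConductor.PersistenceSurfaceRational
open Summit.ResolutionOfSingularities.ResolutionOfSingularities.Theorems.HomologicalConductor.PersistenceSurfaceRationalAssembly

/-- [OURS · w44b v8.2 · o6b] LEVEL-FOUR PERSISTENCE on the class (R♮): the binders of `PersistenceSurface`, plus «stage 0
`T₀ = loc A` is NORMAL with a rational singularity (Lipman (1.1), W4.4's `HasRationalSingularity`) or is regular» ⇒
`ca⁴(T_m) ⊆ ca⁴(T_(m+1))` for every `m` — the typed TARGET of programme M-rat₄ on its proper regime (tri-1 TRIAGE v4 J-A: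
the o6 class (R) without normality also contains Σ8 specimens). NOT a statement of the manuscript. -/
@[conjecture]
def LevelFourPersistenceRationalNormal : Prop :=
  ∀ p : ℕ, p.Prime → ∀ (k K : Type) [Field k] [CharP k p] [Field K] [Algebra k K] (O : ValuationSubring K) (A : Subalgebra k K), (∀ c : k, algebraMap k K c ∈ O) → A.FG → IsFractionRing ↥A K → A.toSubring ≤ O.toSubring → ringKrullDim ↥A ≤ 2 → let caAt : ℕ → Subalgebra k K → Set K := fun n A => {x : K | ∃ hx : x ∈ A, ∀ i : ℕ, n ≤ i → ∀ (M N : ModuleCat.{0} ↥A), Module.Finite ↥A M → Module.Finite ↥A N → ∀ e : CategoryTheory.Abelian.Ext.{0} M N i, (⟨x, hx⟩ : ↥A) • e = 0}; let ca : Subalgebra k K → Set K := fun A => {x : K | ∃ hx : x ∈ A, ∃ n : ℕ, ∀ i : ℕ, n ≤ i → ∀ (M N : ModuleCat.{0} ↥A), Module.Finite ↥A M → Module.Finite ↥A N → ∀ e : CategoryTheory.Abelian.Ext.{0} M N i, (⟨x, hx⟩ : ↥A) • e = 0}; let loc : Subalgebra k K → Subalgebra k K := fun A => Algebra.adjoin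 k {y : K | ∃ a ∈ A, ∃ s ∈ A, s⁻¹ ∈ O ∧ y = a * s⁻¹}; let chart : Subalgebra k K → Subalgebra k K := fun A => Algebra.adjoin k ((A : Set K) ∪ {y : K | ∃ c ∈ ca A, ∃ x ∈ ca A, x ≠ 0 ∧ (∀ c' ∈ ca A, c' * x⁻¹ ∈ O) ∧ y = c * x⁻¹}); let nrm : Subalgebra k K → Subalgebra k K := fun B => Algebra.adjoin k {y : K | IsIntegral ↥B y}; let tower : Subalgebra k K → ℕ → Subalgebra k K := fun A m => @Nat.rec (fun _ => Subalgebra k K) (loc A) (fun _ B => loc (nrm (chart B))) m; ((IsIntegrallyClosed ↥(tower A 0) ∧ Literature.AlgebraicGeometry.Resolution.HasRationalSingularity ↥(tower A 0)) ∨ IsRegularLocalRing ↥(tower A 0)) → ∀ m : ℕ, caAt 4 (tower A m) ⊆ caAt 4 (tower A (m + 1))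

/-- [OURS · w44b v8.2 · o6b] LEVEL-FOUR PERSISTENCE on the complementary class: stage 0 NOT (normal-rational or regular)
— non-normal (Σ8), or normal non-rational (Σ6). Specimen-driven; a failure here would NOT refute `PersistenceSurface`.
NOT a statement of the manuscript. -/
@[conjecture]
def LevelFourPersistenceNonnormalOrNonrational : Prop :=
  ∀ p : ℕ, p.Prime → ∀ (k K : Type) [Field k] [CharP k p] [Field K] [Algebra k K] (O : ValuationSubring K) (A : Subalgebra k K), (∀ c : k, algebraMap k K c ∈ O) → A.FG → IsFractionRing ↥A K → A.toSubring ≤ O.toSubring → ringKrullDim ↥A ≤ 2 → let caAt : ℕ → Subalgebra k K → Set K := fun n A => {x : K | ∃ hx : x ∈ A, ∀ i : ℕ, n ≤ i → ∀ (M N : ModuleCat.{0} ↥A), Module.Finite ↥A M → Module.Finite ↥A N → ∀ e : CategoryTheory.Abelian.Ext.{0} M N i, (⟨x, hx⟩ : ↥A) • e = 0}; let ca : Subalgebra k K → Set K := fun A => {x : K | ∃ hx : x ∈ A, ∃ n : ℕ, ∀ i : ℕ, n ≤ i → ∀ (M N : ModuleCat.{0} ↥A), Module.Finite ↥A M → Module.Finite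 ↥A N → ∀ e : CategoryTheory.Abelian.Ext.{0} M N i, (⟨x, hx⟩ : ↥A) • e = 0}; let loc : Subalgebra k K → Subalgebra k K := fun A => Algebra.adjoin k {y : K | ∃ a ∈ A, ∃ s ∈ A, s⁻¹ ∈ O ∧ y = a * s⁻¹}; let chart : Subalgebra k K → Subalgebra k K := fun A => Algebra.adjoin k ((A : Set K) ∪ {y : K | ∃ c ∈ ca A, ∃ x ∈ ca A, x ≠ 0 ∧ (∀ c' ∈ ca A, c' * x⁻¹ ∈ O) ∧ y = c * x⁻¹}); let nrm : Subalgebra k K → Subalgebra k K := fun B => Algebra.adjoin k {y : K | IsIntegral ↥B y}; let tower : Subalgebra k K → ℕ → Subalgebra k K := fun A m => @Nat.rec (fun _ => Subalgebra k K) (loc A) (fun _ B => loc (nrm (chart B))) m; ¬ ((IsIntegrallyClosed ↥(tower A 0) ∧ Literature.AlgebraicGeometry.Resolution.HasRationalSingularity ↥(tower A 0)) ∨ IsRegularLocalRing ↥(tower A 0)) → ∀ m : ℕ, caAt 4 (tower A m) ⊆ caAt 4 (tower A (m + 1))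

/-- [OURS · w44b v8.2 · o6b] SATURATION AT LEVEL FOUR on the class (R♮): `ca(T_m) ⊆ ca⁴(T_m)` at every stage of a
tower whose stage 0 is normal-rational or regular. NOT a statement of the manuscript. -/
@[conjecture]
def SaturationFourRationalNormal : Prop :=
  ∀ p : ℕ, p.Prime → ∀ (k K : Type) [Field k] [CharP k p] [Field K] [Algebra k K] (O : ValuationSubring K) (A : Subalgebra k K), (∀ c : k, algebraMap k K c ∈ O) → A.FG → IsFractionRing ↥A K → A.toSubring ≤ O.toSubring → ringKrullDim ↥A ≤ 2 → let caAt : ℕ → Subalgebra k K → Set K := fun n A => {x : K | ∃ hx : x ∈ A, ∀ i : ℕ, n ≤ i → ∀ (M N : ModuleCat.{0} ↥A), Module.Finite ↥A M → Module.Finite ↥A N → ∀ e : CategoryTheory.Abelian.Ext.{0} M N i, (⟨x, hx⟩ : ↥A) • e = 0}; let ca : Subalgebra k K → Set K := fun A => {x : K | ∃ hx : x ∈ A, ∃ n : ℕ, ∀ i : ℕ, n ≤ i → ∀ (M N : ModuleCat.{0} ↥A), Module.Finite ↥A M → Module.Finite ↥A N → ∀ e : CategoryTheory.Abelian.Ext.{0}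 M N i, (⟨x, hx⟩ : ↥A) • e = 0}; let loc : Subalgebra k K → Subalgebra k K := fun A => Algebra.adjoin k {y : K | ∃ a ∈ A, ∃ s ∈ A, s⁻¹ ∈ O ∧ y = a * s⁻¹}; let chart : Subalgebra k K → Subalgebra k K := fun A => Algebra.adjoin k ((A : Set K) ∪ {y : K | ∃ c ∈ ca A, ∃ x ∈ ca A, x ≠ 0 ∧ (∀ c' ∈ ca A, c' * x⁻¹ ∈ O) ∧ y = c * x⁻¹}); let nrm : Subalgebra k K → Subalgebra k K := fun B => Algebra.adjoin k {y : K | IsIntegral ↥B y}; let tower : Subalgebra k K → ℕ → Subalgebra k K := fun A m => @Nat.rec (fun _ => Subalgebra k K) (loc A) (fun _ B => loc (nrm (chart B))) m; ((IsIntegrallyClosed ↥(tower A 0) ∧ Literature.AlgebraicGeometry.Resolution.HasRationalSingularity ↥(tower A 0)) ∨ IsRegularLocalRing ↥(tower A 0)) → ∀ m : ℕ, ca (tower A m) ⊆ caAt 4 (tower A m)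

/-- [OURS · w44b v8.2 · o6b] SATURATION AT LEVEL FOUR on the complementary class (Σ6 ∪ Σ8). NOT a statement of the
manuscript. -/
@[conjecture]
def SaturationFourNonnormalOrNonrational : Prop :=
  ∀ p : ℕ, p.Prime → ∀ (k K : Type) [Field k] [CharP k p] [Field K] [Algebra k K] (O : ValuationSubring K) (A : Subalgebra k K), (∀ c : k, algebraMap k K c ∈ O) → A.FG → IsFractionRing ↥A K → A.toSubring ≤ O.toSubring → ringKrullDim ↥A ≤ 2 → let caAt : ℕ → Subalgebra k K → Set K := fun n A => {x : K | ∃ hx : x ∈ A, ∀ i : ℕ, n ≤ i → ∀ (M N : ModuleCat.{0} ↥A), Module.Finite ↥A M → Module.Finite ↥A N → ∀ e : CategoryTheory.Abelian.Ext.{0} M N i, (⟨x, hx⟩ : ↥A) • e = 0}; let ca : Subalgebra k K → Set K := fun A => {x : K | ∃ hx : x ∈ A, ∃ n : ℕ, ∀ i : ℕ, n ≤ i → ∀ (M N : ModuleCat.{0} ↥A), Module.Finite ↥A M → Module.Finite ↥A N → ∀ e : CategoryTheory.Abelian.Ext.{0} M N i, (⟨x, hx⟩ : ↥A) • e = 0};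 let loc : Subalgebra k K → Subalgebra k K := fun A => Algebra.adjoin k {y : K | ∃ a ∈ A, ∃ s ∈ A, s⁻¹ ∈ O ∧ y = a * s⁻¹}; let chart : Subalgebra k K → Subalgebra k K := fun A => Algebra.adjoin k ((A : Set K) ∪ {y : K | ∃ c ∈ ca A, ∃ x ∈ ca A, x ≠ 0 ∧ (∀ c' ∈ ca A, c' * x⁻¹ ∈ O) ∧ y = c * x⁻¹}); let nrm : Subalgebra k K → Subalgebra k K := fun B => Algebra.adjoin k {y : K | IsIntegral ↥B y}; let tower : Subalgebra k K → ℕ → Subalgebra k K := fun A m => @Nat.rec (fun _ => Subalgebra k K) (loc A) (fun _ B => loc (nrm (chart B))) m; ¬ ((IsIntegrallyClosed ↥(tower A 0) ∧ Literature.AlgebraicGeometry.Resolution.HasRationalSingularity ↥(tower A 0)) ∨ IsRegularLocalRing ↥(tower A 0)) → ∀ m : ℕ, ca (tower A m) ⊆ caAt 4 (tower A m)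

/-! ## Glue (excluded middle on the stage-0 predicate) -/

/-- GLUE: the two classes exhaust all towers. [folklore] -/
theorem levelFourPersistenceSurface_of_rationalNormal_of_rest
    (hR : LevelFourPersistenceRationalNormal) (hN : LevelFourPersistenceNonnormalOrNonrational) :
    LevelFourPersistenceSurface := by
  intro p hp k K _ _ _ _ O A hk hA hfr hAO hdim caAt ca loc chart nrm tower m x hx
  rcases Classical.em ((IsIntegrallyClosed ↥(tower A 0) ∧
      Literature.AlgebraicGeometry.Resolution.HasRationalSingularity ↥(tower A 0)) ∨
      IsRegularLocalRing ↥(tower A 0)) with h | h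
  · exact hR p hp k K O A hk hA hfr hAO hdim h m hx
  · exact hN p hp k K O A hk hA hfr hAO hdim h m hx

/-- GLUE for saturation. [folklore] -/
theorem saturationFourSurface_of_rationalNormal_of_rest
    (hR : SaturationFourRationalNormal) (hN : SaturationFourNonnormalOrNonrational) : SaturationFourSurface := by
  intro p hp k K _ _ _ _ O A hk hA hfr hAO hdim caAt ca loc chart nrm tower m x hx
  rcases Classical.em ((IsIntegrallyClosed ↥(tower A 0) ∧
      Literature.AlgebraicGeometry.Resolution.HasRationalSingularity ↥(tower A 0)) ∨
      IsRegularLocalRing ↥(tower A 0)) with h | h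
  · exact hR p hp k K O A hk hA hfr hAO hdim h m hx
  · exact hN p hp k K O A hk hA hfr hAO hdim h m hx

/-- THE FOUR-PIECE GLUE on the normal re-cut: the rung `PersistenceSurface`. [folklore] -/
theorem persistenceSurface_of_normalPieces (hSR : SaturationFourRationalNormal)
    (hSN : SaturationFourNonnormalOrNonrational) (hLR : LevelFourPersistenceRationalNormal)
    (hLN : LevelFourPersistenceNonnormalOrNonrational) :
    Summit.ResolutionOfSingularities.ResolutionOfSingularities.Theses.HomologicalConductor.PersistenceSurface :=
  persistenceSurface_of_saturationFour_of_levelFour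
    (saturationFourSurface_of_rationalNormal_of_rest hSR hSN)
    (levelFourPersistenceSurface_of_rationalNormal_of_rest hLR hLN)

/-! ## Free comparisons with the o6 partition -/

/-- (R♮) ⊆ (R): o6's `LevelFourPersistenceRational` gives the normal-rational statement. [folklore] -/
theorem levelFourPersistenceRationalNormal_of_rational (h : LevelFourPersistenceRational) :
    LevelFourPersistenceRationalNormal := by
  intro p hp k K _ _ _ _ O A hk hA hfr hAO hdim caAt ca loc chart nrm tower hRN m x hx
  have hR : Literature.AlgebraicGeometry.Resolution.HasRationalSingularity ↥(tower A 0) ∨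
      IsRegularLocalRing ↥(tower A 0) := hRN.imp (fun h => h.2) id
  exact h p hp k K O A hk hA hfr hAO hdim hR m hx

/-- ¬(R) ⊆ ¬(R♮): the complementary statement here gives o6's `LevelFourPersistenceNonrational`. [folklore] -/
theorem levelFourPersistenceNonrational_of_rest (h : LevelFourPersistenceNonnormalOrNonrational) :
    LevelFourPersistenceNonrational := by
  intro p hp k K _ _ _ _ O A hk hA hfr hAO hdim caAt ca loc chart nrm tower hN m x hx
  have hN' : ¬ ((IsIntegrallyClosed ↥(tower A 0) ∧
      Literature.AlgebraicGeometry.Resolution.HasRationalSingularity ↥(tower A 0)) ∨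
      IsRegularLocalRing ↥(tower A 0)) := fun h' => hN (h'.imp (fun h => h.2) id)
  exact h p hp k K O A hk hA hfr hAO hdim hN' m hx

/-- (R♮) ⊆ (R) for saturation. [folklore] -/
theorem saturationFourRationalNormal_of_rational (h : SaturationFourRational) : SaturationFourRationalNormal := by
  intro p hp k K _ _ _ _ O A hk hA hfr hAO hdim caAt ca loc chart nrm tower hRN m x hx
  have hR : Literature.AlgebraicGeometry.Resolution.HasRationalSingularity ↥(tower A 0) ∨
      IsRegularLocalRing ↥(tower A 0) := hRN.imp (fun h => h.2) id
  exact h p hp k K O A hk hA hfr hAO hdim hR m hx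

/-- ¬(R) ⊆ ¬(R♮) for saturation. [folklore] -/
theorem saturationFourNonrational_of_rest (h : SaturationFourNonnormalOrNonrational) :
    SaturationFourNonrational := by
  intro p hp k K _ _ _ _ O A hk hA hfr hAO hdim caAt ca loc chart nrm tower hN m x hx
  have hN' : ¬ ((IsIntegrallyClosed ↥(tower A 0) ∧
      Literature.AlgebraicGeometry.Resolution.HasRationalSingularity ↥(tower A 0)) ∨
      IsRegularLocalRing ↥(tower A 0)) := fun h' => hN (h'.imp (fun h => h.2) id)
  exact h p hp k K O A hk hA hfr hAO hdim hN' m hx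

/-! ## The step-dual-cover premise on the normal re-cut -/

/-- [OURS · w44b v8.2 · o6b] o8's `RationalStepDualCover` with the stage-0 class (R♮): every step of a surface tower
whose stage 0 is normal with a rational singularity, or regular, has a level-four dual cover (`HasStepDualCover`, o8
p507867). NOT a statement of the manuscript. -/
@[conjecture]
def RationalNormalStepDualCover : Prop :=
  ∀ p : ℕ, p.Prime → ∀ (k K : Type) [Field k] [CharP k p] [Field K] [Algebra k K]
    (O : ValuationSubring K) (A : Subalgebra k K), (∀ c : k, algebraMap k K c ∈ O) → A.FG →
    IsFractionRing ↥A K → A.toSubring ≤ O.toSubring → ringKrullDim ↥A ≤ 2 →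
    ((IsIntegrallyClosed ↥(tower O A 0) ∧
      Literature.AlgebraicGeometry.Resolution.HasRationalSingularity ↥(tower O A 0)) ∨
      IsRegularLocalRing ↥(tower O A 0)) →
    ∀ (m : ℕ) (hle : tower O A m ≤ tower O A (m + 1)),
      letI := (Subalgebra.inclusion hle).toRingHom.toAlgebra
      HasStepDualCover ↥(tower O A m) ↥(tower O A (m + 1))

/-- (R♮) ⊆ (R): o8's `RationalStepDualCover` gives the normal-rational premise. [folklore] -/
theorem rationalNormalStepDualCover_of_rational (h : RationalStepDualCover) : RationalNormalStepDualCover := by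
  intro p hp k K _ _ _ _ O A hk hA hfr hAO hdim hRN m hle
  exact h p hp k K O A hk hA hfr hAO hdim (hRN.imp (fun h => h.2) id) m hle

/-- **THE ASSEMBLY on the normal re-cut (OURS · w44b-o6b):**
`RationalNormalStepDualCover → LevelFourPersistenceRationalNormal` (o8's proof with the (R♮) hypothesis threaded:
`x ∈ ca⁴(T_m)` ⇒ ascent ⇒ CA1 ⇒ FC-4 ⇒ descent, all inside
`algebraMap_mem_cohomologyAnnihilatorOfDegree_four_of_hasStepDualCover`). [folklore] -/
theorem levelFourPersistenceRationalNormal_of_rationalNormalStepDualCover (h : RationalNormalStepDualCover) :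
    LevelFourPersistenceRationalNormal := by
  intro p hp k K _ _ _ _ O A hk hA hfr hAO hdim caAt ca loc chart nrm tower' hRN m x hx
  obtain ⟨hxT, hx4⟩ := hx
  -- `T_m ≤ T_(m+1) = loc (nrm (chart T_m))`
  have hle : tower O A m ≤ tower O A (m + 1) := fun y hy => by
    rw [tower_succ]
    exact SyzygyFlattening.self_le_locAt O _
      (SyzygyFlattening.self_le_nrm _ (Algebra.subset_adjoin (Or.inl hy)))
  letI := (Subalgebra.inclusion hle).toRingHom.toAlgebra
  have hstep : HasStepDualCover ↥(tower O A m) ↥(tower O A (m + 1)) :=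
    h p hp k K O A hk hA hfr hAO hdim hRN m hle
  have hx' : (⟨x, hxT⟩ : ↥(tower O A m)) ∈ cohomologyAnnihilatorOfDegree ↥(tower O A m) 4 :=
    mem_cohomologyAnnihilatorOfDegree_iff.mpr hx4
  have hmem := algebraMap_mem_cohomologyAnnihilatorOfDegree_four_of_hasStepDualCover hstep hx'
  exact ⟨hle hxT, mem_cohomologyAnnihilatorOfDegree_iff.mp hmem⟩

end Summit.ResolutionOfSingularities.ResolutionOfSingularities.Theorems.HomologicalConductor.PersistenceSurfaceNormalPartition

end
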